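import Summits.Ventures.CertifiedManyBodySolver.Downfold.TperpSeam
import Summits.Ventures.CertifiedManyBodySolver.Downfold.BoxesYBCO7
import Summits.Ventures.CertifiedManyBodySolver.Certificates.HubbardSquare_affwords_sandwich_YBCO7
import Summits.Ventures.CertifiedManyBodySolver.Certificates.HubbardDimer_openBox2x1_sectorFloors
import Literature.MathematicalPhysics.QuantumLattice.PeriodicLayeredLatticeDimerDressedTransport
import Literature.MathematicalPhysics.QuantumLattice.HubbardNNNHoppingEnergyDensityMonotone
import Literature.MathematicalPhysics.QuantumLattice.HubbardTTPrimeBoxWordExtension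
import HarnessLib

/-!
# The INTERLAYER seam, `U`-DRESSED edition: a bilayer-crystal floor whose intra-bilayer allowance is a Hubbard
# DIMER row `|t⊥|·A(V, n)` plus an in-plane floor read `V·t⊥` lower in `U`, instead of the kinematic `|t⊥|`

Venture CertifiedManyBodySolver, stage S1 ↔ S2 seam (cell `pub/hubbard-downfold`'s grammar: `OneBandBox`, `Entry`, `HoldsOn`);
ADAPTER contributed by the S2 seat `hubbard-box-p3` (cell `pub/hubbard-fast`, 2026-08-28) for the Literature law
`PeriodicLayeredLatticeDimerDressedTransport` (`le_infCellEnergyOn_bilayerHubbardTTPrime_dimer_unitRows`): the intra-bilayer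
bonds of the period-2 stacked `t–t'` crystal are disjoint Hubbard dimers, so with unit-hopping dimer rows
`a + b k ≤ E₀(h_{2×1}(1, 0, V), k)` (`k ≤ 4`; kernel tables `Certificates/HubbardDimer_openBox2x1_sectorFloors`, `V ∈ {0, 2, 4, 8}`)
every member `p` of a box obeys `e(1, tp, U − V·t⊥, n) + t⊥·(a/2 + b n) − |t⊥'| ≤ inf_{period-2 periodic, filling n} e(bilayer crystal)`.
Companion of hubbard-box-p1's `TperpSeam.holdsOn_bilayerHubbardTTPrime_of_window` (floor `L − 2·mZ`, `mZ = max |eZ.lo| |eZ.hi|`).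

* `mul_half_affine_ge_of_corners` — the bilinear term `z·(a/2 + b n)` over a rectangle `[zlo, zhi] × [nlo, nhi]` (`zlo ≥ 0`) is
  floored by its four corner values.
* **`holdsOn_bilayerHubbardTTPrime_floor_of_anchorCell_dimer`** — THE DRESSED BILAYER FLOOR SEAM: a box `B` with entries
  `eU, eS, eN, eZ` (`0 < eN.lo`, `eN.hi < 2`, `eZ.lo ≥ 0`), an S2 FLOOR `L` on a SOURCE CELL `Set.Icc ![U₁',s₁',n₁'] ![U₂',s₂',n₂']`
  whose `U`-range contains an anchor column `U_a ≥ 0` with `U_a + V·eZ.hi ≤ eU.lo` (`V ≥ 0`) and whose `tp`, `n` ranges cover the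
  box's entries, unit dimer rows `(a, b)` at `V`, and a constant `c ≤ z·(a/2 + b n)` on `[eZ.lo, eZ.hi] × [eN.lo, eN.hi]` give, on `B`,
  for every inter-bilayer `|t⊥'| ≤ |p tperp/t|`: `L + c − mZ ≤ inf_{periodic, filling p n} e(bilayer crystal at p)`.
* `holdsOn_bilayerHubbardTTPrime_window_of_anchorCell_dimer` — the same floor together with the box's own S2 cap `R`
  (`eU.lo ≥ 0`; the cap of a stacked crystal is the in-plane cap, as in the kinematic seam).
* instance **`boxYBCO7M_M18_bilayer_floor_dimerV8`** (YBa₂Cu₃O₆.₉₂, VALIDATION-SET #18, `tperp/t ∈ [3/10, 9/20]`): with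
  hubbard-box-p2's HYPOTHESIS-FREE `U`-uniform floor `aw_ybco7M_M18_word` (`−1.5601315986` on `U/t ∈ [0, 20]`, so the anchor `U_a = 0`
  costs nothing) and the `V = 8` dimer chord through `k = 1, 2`: **`−1.5601315986 − 0.1502043 − 9/20 ≤ inf …`**, i.e. `−2.1603359`
  against the kinematic seam's `−1.5601315986 − 2·(9/20) = −2.4601316` (`boxYBCO7M_M18_bilayerEnergyWord`): the intra-bilayer
  allowance `9/20` becomes `0.1502043`; the inter-bilayer `t⊥'` (typed only as `|t⊥'| ≤ |t⊥|`) keeps `9/20`.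

Everything is PROVED; no definition, no number of record. HONEST FRAMING: energy bookkeeping of the interlayer truncation (variational cell
energies of the period-2 stacked one-band crystal over its period-2 periodic states); inputs are S2 words and kernel dimer tables BY NAME; a
downfolded box is a modelling claim (`B.Mem p`); nothing here is an order, pairing or `T_c` statement, and no material number is certified
beyond the stated energy inequality.
-/

noncomputable section

namespace Summit.Ventures.CertifiedManyBodySolver.Downfold

open NonemptyInterval Literature.MathematicalPhysics.QuantumLattice
  Literature.MathematicalPhysics.QuantumLattice.ThermodynamicLimit Literature.Probability.LatticeModels
open Summit.Ventures.CertifiedManyBodySolver.Certificates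

/-- **Corner rule for the dressed term**: on `[zlo, zhi] × [nlo, nhi]` with `zlo ≥ 0`, the bilinear `z·(a/2 + b n)` is at least any
`c` below its four corner values (affine in `n` at fixed `z`, affine in `z` at fixed `n`). [folklore] -/
theorem mul_half_affine_ge_of_corners {zlo zhi nlo nhi a b c : ℝ} (hz0 : 0 ≤ zlo)
    (h1 : c ≤ zlo * (2⁻¹ * (a + 2 * b * nlo))) (h2 : c ≤ zlo * (2⁻¹ * (a + 2 * b * nhi)))
    (h3 : c ≤ zhi * (2⁻¹ * (a + 2 * b * nlo))) (h4 : c ≤ zhi * (2⁻¹ * (a + 2 * b * nhi)))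
    {z n : ℝ} (hz : zlo ≤ z ∧ z ≤ zhi) (hn : nlo ≤ n ∧ n ≤ nhi) :
    c ≤ z * (2⁻¹ * (a + 2 * b * n)) := by
  have hz0' : 0 ≤ z := hz0.trans hz.1
  rcases le_total 0 b with hb | hb
  · have hg : 2⁻¹ * (a + 2 * b * nlo) ≤ 2⁻¹ * (a + 2 * b * n) := by nlinarith [hn.1]
    have h5 : z * (2⁻¹ * (a + 2 * b * nlo)) ≤ z * (2⁻¹ * (a + 2 * b * n)) := mul_le_mul_of_nonneg_left hg hz0'
    rcases le_total 0 (2⁻¹ * (a + 2 * b * nlo)) with hm | hm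
    · linarith [mul_le_mul_of_nonneg_right hz.1 hm]
    · linarith [mul_le_mul_of_nonpos_right hz.2 hm]
  · have hg : 2⁻¹ * (a + 2 * b * nhi) ≤ 2⁻¹ * (a + 2 * b * n) := by nlinarith [hn.2]
    have h5 : z * (2⁻¹ * (a + 2 * b * nhi)) ≤ z * (2⁻¹ * (a + 2 * b * n)) := mul_le_mul_of_nonneg_left hg hz0'
    rcases le_total 0 (2⁻¹ * (a + 2 * b * nhi)) with hm | hm
    · linarith [mul_le_mul_of_nonneg_right hz.1 hm]
    · linarith [mul_le_mul_of_nonpos_right hz.2 hm]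

/-- **THE DRESSED BILAYER FLOOR SEAM.** Let `B` carry entries `eU, eS, eN, eZ` (`U/t`, `tp/t`, `n`, `tperp/t`) with `0 < eN.lo`,
`eN.hi < 2`, `0 ≤ eZ.lo`, `mZ = max |eZ.lo| |eZ.hi|`. Let an S2 FLOOR `L` hold on a source cell `Set.Icc ![U₁',s₁',n₁'] ![U₂',s₂',n₂']`
(coordinates `(U/t, tp/t, n)`), whose `U`-range contains an anchor column `U_a ≥ 0` with `U_a + V·eZ.hi ≤ eU.lo` (`V ≥ 0`) and whose
`tp`, `n` ranges cover the box's entries; let `a + b k ≤ E₀(h_{2×1}(1, 0, V), k)` (`k ≤ 4`) be unit dimer rows and `c ≤ z·(a/2 + b n)` on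
`[eZ.lo, eZ.hi] × [eN.lo, eN.hi]`. Then on `B`, for every `|t⊥'| ≤ |p tperp/t|`:
`L + c − mZ ≤ inf_{period-2 periodic, cell filling p n} e(bilayer t–t' crystal at (p tp/t, p U/t; p tperp/t, t⊥'))`.
[cite: Anderson1951, eq. (2)] -/
theorem holdsOn_bilayerHubbardTTPrime_floor_of_anchorCell_dimer {B : OneBandBox} {eU eS eN eZ : Entry}
    (hU : B .UOverT = some eU) (hS : B .tpOverT = some eS) (hN : B .filling = some eN)
    (hZ : B .tperpOverT = some eZ) (hN0 : 0 < eN.encl.fst) (hN2 : eN.encl.snd < 2) (hZ0 : 0 ≤ eZ.encl.fst)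
    {Ulo' slo' nlo' Uhi' shi' nhi' L : ℝ}
    (hL : ∀ θ ∈ Set.Icc (![Ulo', slo', nlo'] : Fin 3 → ℝ) ![Uhi', shi', nhi'],
      L ≤ energyDensityTT' 1 (θ 1) (θ 0) (θ 2))
    {Ua V : ℝ} (hUa0 : 0 ≤ Ua) (hUa : Ulo' ≤ Ua ∧ Ua ≤ Uhi')
    (hS' : slo' ≤ ((eS.encl.fst : ℚ) : ℝ) ∧ ((eS.encl.snd : ℚ) : ℝ) ≤ shi')
    (hN' : nlo' ≤ ((eN.encl.fst : ℚ) : ℝ) ∧ ((eN.encl.snd : ℚ) : ℝ) ≤ nhi') (hV : 0 ≤ V)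
    (hUaU : Ua + V * ((eZ.encl.snd : ℚ) : ℝ) ≤ ((eU.encl.fst : ℚ) : ℝ))
    {a b : ℝ} (hrow : ∀ k : ℕ, k ≤ 4 → a + b * k ≤ groundEnergy (hubbardOpenBoxTT' 2 1 1 0 V) k)
    {c : ℝ}
    (hc : ∀ z n : ℝ, ((eZ.encl.fst : ℚ) : ℝ) ≤ z ∧ z ≤ ((eZ.encl.snd : ℚ) : ℝ) →
      ((eN.encl.fst : ℚ) : ℝ) ≤ n ∧ n ≤ ((eN.encl.snd : ℚ) : ℝ) → c ≤ z * (2⁻¹ * (a + 2 * b * n))) :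
    HoldsOn (fun p : OneBandCoord → ℝ => ∀ tperp' : ℝ, |tperp'| ≤ |p .tperpOverT| →
      L + c - ((max |eZ.encl.fst| |eZ.encl.snd| : ℚ) : ℝ) ≤
        infCellEnergyOn (periodicStatesAt (stackPeriods 2 1) (p .filling))
          (periodicLayeredHubbardTTPrimeViews 1 1 (p .tpOverT) (p .UOverT)
            (fun _ : Fin 1 => (unitVec (0 : Fin 3) : Site 3)) fun j _ => ![p .tperpOverT, tperp'] j) 1) B := by
  intro p hp tperp' htp
  have hu := mem_ratCast_iff.1 (hp _ _ hU)
  have hs := mem_ratCast_iff.1 (hp _ _ hS)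
  have hn := mem_ratCast_iff.1 (hp _ _ hN)
  have hz := mem_ratCast_iff.1 (hp _ _ hZ)
  have hN0' : (0 : ℝ) < ((eN.encl.fst : ℚ) : ℝ) := by exact_mod_cast hN0
  have hN2' : ((eN.encl.snd : ℚ) : ℝ) < 2 := by exact_mod_cast hN2
  have hZ0' : (0 : ℝ) ≤ ((eZ.encl.fst : ℚ) : ℝ) := by exact_mod_cast hZ0
  have hn0 : 0 < p .filling := lt_of_lt_of_le hN0' hn.1
  have hn2 : p .filling < 2 := lt_of_le_of_lt hn.2 hN2'
  have hz0 : 0 ≤ p .tperpOverT := hZ0'.trans hz.1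
  have hVz : V * p .tperpOverT ≤ V * ((eZ.encl.snd : ℚ) : ℝ) := mul_le_mul_of_nonneg_left hz.2 hV
  have hUW : Ua ≤ p .UOverT - V * p .tperpOverT := by linarith [hu.1]
  have hUW0 : 0 ≤ p .UOverT - V * p .tperpOverT := hUa0.trans hUW
  -- the law at the member
  have hlaw := le_infCellEnergyOn_bilayerHubbardTTPrime_dimer_unitRows 1 (p .tpOverT) hz0 hUW0 hn0 hn2 tperp' hrow
  -- the in-plane floor, read at the anchor column
  have hmono := energyDensityTT'_mono_U 1 (p .tpOverT) hn0.le hn2 hUa0 hUW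
  have hmem : (![Ua, p .tpOverT, p .filling] : Fin 3 → ℝ) ∈
      Set.Icc (![Ulo', slo', nlo'] : Fin 3 → ℝ) ![Uhi', shi', nhi'] :=
    mem_Icc_vec3_iff.2 ⟨⟨hUa.1, hUa.2⟩, ⟨hS'.1.trans hs.1, hs.2.trans hS'.2⟩, ⟨hN'.1.trans hn.1, hn.2.trans hN'.2⟩⟩
  have hθ := hL _ hmem
  have e0 : (![Ua, p .tpOverT, p .filling] : Fin 3 → ℝ) 0 = Ua := rfl
  have e1 : (![Ua, p .tpOverT, p .filling] : Fin 3 → ℝ) 1 = p .tpOverT := rfl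
  have e2 : (![Ua, p .tpOverT, p .filling] : Fin 3 → ℝ) 2 = p .filling := rfl
  rw [e0, e1, e2] at hθ
  -- the dressed term and the inter-bilayer allowance
  have hcc := hc (p .tperpOverT) (p .filling) hz hn
  have hmZ : |tperp'| ≤ ((max |eZ.encl.fst| |eZ.encl.snd| : ℚ) : ℝ) := htp.trans (Entry.abs_le_of_mem (hp _ _ hZ))
  linarith

/-- **THE DRESSED BILAYER WINDOW SEAM**: the floor of `holdsOn_bilayerHubbardTTPrime_floor_of_anchorCell_dimer` together with the
box's OWN S2 cap `R` (`∀ θ ∈ Set.Icc (s2Lo eU eS eN) (s2Hi eU eS eN), energyDensityTT' 1 (θ 1) (θ 0) (θ 2) ≤ R`, `eU.lo ≥ 0`) — the cap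
of a stacked crystal is the in-plane cap (the stack of an in-plane minimiser sees no interlayer bond). On `B`, for every
`|t⊥'| ≤ |p tperp/t|`: `L + c − mZ ≤ inf … ≤ R`. [cite: BratteliKishimotoRobinson1978, Thm. 2 (condition 2)] -/
theorem holdsOn_bilayerHubbardTTPrime_window_of_anchorCell_dimer {B : OneBandBox} {eU eS eN eZ : Entry}
    (hU : B .UOverT = some eU) (hS : B .tpOverT = some eS) (hN : B .filling = some eN)
    (hZ : B .tperpOverT = some eZ) (hU0 : 0 ≤ eU.encl.fst) (hN0 : 0 < eN.encl.fst) (hN2 : eN.encl.snd < 2)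
    (hZ0 : 0 ≤ eZ.encl.fst)
    {Ulo' slo' nlo' Uhi' shi' nhi' L : ℝ}
    (hL : ∀ θ ∈ Set.Icc (![Ulo', slo', nlo'] : Fin 3 → ℝ) ![Uhi', shi', nhi'],
      L ≤ energyDensityTT' 1 (θ 1) (θ 0) (θ 2))
    {R : ℝ} (hR : ∀ θ ∈ Set.Icc (s2Lo eU eS eN) (s2Hi eU eS eN), energyDensityTT' 1 (θ 1) (θ 0) (θ 2) ≤ R)
    {Ua V : ℝ} (hUa0 : 0 ≤ Ua) (hUa : Ulo' ≤ Ua ∧ Ua ≤ Uhi')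
    (hS' : slo' ≤ ((eS.encl.fst : ℚ) : ℝ) ∧ ((eS.encl.snd : ℚ) : ℝ) ≤ shi')
    (hN' : nlo' ≤ ((eN.encl.fst : ℚ) : ℝ) ∧ ((eN.encl.snd : ℚ) : ℝ) ≤ nhi') (hV : 0 ≤ V)
    (hUaU : Ua + V * ((eZ.encl.snd : ℚ) : ℝ) ≤ ((eU.encl.fst : ℚ) : ℝ))
    {a b : ℝ} (hrow : ∀ k : ℕ, k ≤ 4 → a + b * k ≤ groundEnergy (hubbardOpenBoxTT' 2 1 1 0 V) k)
    {c : ℝ}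
    (hc : ∀ z n : ℝ, ((eZ.encl.fst : ℚ) : ℝ) ≤ z ∧ z ≤ ((eZ.encl.snd : ℚ) : ℝ) →
      ((eN.encl.fst : ℚ) : ℝ) ≤ n ∧ n ≤ ((eN.encl.snd : ℚ) : ℝ) → c ≤ z * (2⁻¹ * (a + 2 * b * n))) :
    HoldsOn (fun p : OneBandCoord → ℝ => ∀ tperp' : ℝ, |tperp'| ≤ |p .tperpOverT| →
      L + c - ((max |eZ.encl.fst| |eZ.encl.snd| : ℚ) : ℝ) ≤
          infCellEnergyOn (periodicStatesAt (stackPeriods 2 1) (p .filling))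
            (periodicLayeredHubbardTTPrimeViews 1 1 (p .tpOverT) (p .UOverT)
              (fun _ : Fin 1 => (unitVec (0 : Fin 3) : Site 3)) fun j _ => ![p .tperpOverT, tperp'] j) 1 ∧
        infCellEnergyOn (periodicStatesAt (stackPeriods 2 1) (p .filling))
            (periodicLayeredHubbardTTPrimeViews 1 1 (p .tpOverT) (p .UOverT)
              (fun _ : Fin 1 => (unitVec (0 : Fin 3) : Site 3)) fun j _ => ![p .tperpOverT, tperp'] j) 1 ≤ R) B := by
  intro p hp tperp' htp
  refine ⟨holdsOn_bilayerHubbardTTPrime_floor_of_anchorCell_dimer hU hS hN hZ hN0 hN2 hZ0 hL hUa0 hUa hS' hN' hV hUaU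
    hrow hc p hp tperp' htp, ?_⟩
  obtain ⟨hu0, hn0, hn2⟩ := mem_sideConditions hU hN hU0 hN0 hN2 hp
  have hθ := s2Coords_mem_Icc hU hS hN hp
  have hRp := hR _ hθ
  have h1 : s2Coords p 1 = p .tpOverT := rfl
  have h0 : s2Coords p 0 = p .UOverT := rfl
  have h2 : s2Coords p 2 = p .filling := rfl
  rw [h1, h0, h2] at hRp
  exact (infCellEnergyOn_bilayerHubbardTTPrime_mem_Icc 1 (p .tpOverT) hu0 hn0 hn2 (p .tperpOverT) tperp').2.trans hRp

/-! ### Instance: YBa₂Cu₃O₆.₉₂ (`boxYBCO7M_M18`, VALIDATION-SET #18, bilayer; `tperp/t ∈ [3/10, 9/20]`) -/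

/-- **The `V = 8` dimer chord through `k = 1, 2` as unit rows on the open `2 × 1` cluster**:
`−1.5279637 + 0.5278635·k ≤ E₀(h_{2×1}(1, 0, 8), k)`, `k ≤ 4` (kernel table `dimer_V8_table` + `dimer_V8_line_k12`).
[cite: KullEtAl2024, §5.3] -/
theorem dimer_V8_rows_k12 : ∀ k : ℕ, k ≤ 4 →
    (((-15279637 : ℚ) / 10000000 : ℚ) : ℝ) + (((1055727 : ℚ) / 2000000 : ℚ) : ℝ) * k ≤
      groundEnergy (hubbardOpenBoxTT' 2 1 1 0 (8 : ℝ)) k := by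
  intro k hk
  have h1 := dimer_V8_line_k12 k hk
  have h2 := dimer_V8_table k hk
  have h1' : (((-15279637 : ℚ) / 10000000 : ℚ) : ℝ) + (((1055727 : ℚ) / 2000000 : ℚ) : ℝ) * k ≤ ((dimer_V8_sigma k : ℚ) : ℝ) := by
    exact_mod_cast h1
  exact h1'.trans h2

/-- **YBa₂Cu₃O₆.₉₂ bilayer floor, `U`-DRESSED (`V = 8`), HYPOTHESIS-FREE.** On `boxYBCO7M_M18` (`U/t ∈ [5.8, 14.8]`, `tp/t ∈ [−0.3, −0.19]`,
`n ∈ [0.815, 0.86]`, `tperp/t ∈ [0.3, 0.45]`), with hubbard-box-p2's `U`-uniform floor `aw_ybco7M_M18_word` (`−1.5601315986` on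
`U/t ∈ [0, 20]`, anchor `U_a = 0`, so `V·t⊥ ≤ 3.6 ≤ 5.8` is free) and the `V = 8` dimer chord: for every member and every inter-bilayer
`|t⊥'| ≤ |p tperp/t|`,
`−1.5601315986 − 0.1502043 − 9/20 ≤ inf_{period-2 periodic, filling p n} e(bilayer t–t' crystal)` — i.e. `−2.1603359…`, against
the kinematic seam's `−2.4601316` (`boxYBCO7M_M18_bilayerEnergyWord`). [cite: Anderson1951, eq. (2)] -/
theorem boxYBCO7M_M18_bilayer_floor_dimerV8 :
    HoldsOn (fun p : OneBandCoord → ℝ => ∀ tperp' : ℝ, |tperp'| ≤ |p .tperpOverT| →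
      (-1.5601315986 : ℝ) + (-0.1502043 : ℝ) - (9/20 : ℝ) ≤
        infCellEnergyOn (periodicStatesAt (stackPeriods 2 1) (p .filling))
          (periodicLayeredHubbardTTPrimeViews 1 1 (p .tpOverT) (p .UOverT)
            (fun _ : Fin 1 => (unitVec (0 : Fin 3) : Site 3)) fun j _ => ![p .tperpOverT, tperp'] j) 1) boxYBCO7M_M18 := by
  have hLw : ∀ θ ∈ Set.Icc (![0, -3/10, 163/200] : Fin 3 → ℝ) ![20, -19/100, 43/50],
      (-1.5601315986 : ℝ) ≤ energyDensityTT' 1 (θ 1) (θ 0) (θ 2) := fun θ hθ => (aw_ybco7M_M18_word θ hθ).1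
  have h := holdsOn_bilayerHubbardTTPrime_floor_of_anchorCell_dimer (B := boxYBCO7M_M18) (eU := yBCO7M_M18_U)
    (eS := yBCO7M_M18_tp) (eN := yBCO7M_M18_n) (eZ := yBCO7M_M18_tperp) rfl rfl rfl rfl
    (by rw [yBCO7M_M18_n, Entry.encl_ofEnds_fst]; norm_num)
    (by rw [yBCO7M_M18_n, Entry.encl_ofEnds_snd]; norm_num)
    (by rw [yBCO7M_M18_tperp, Entry.encl_ofEnds_fst]; norm_num)
    hLw (Ua := 0) (V := 8) le_rfl ⟨le_rfl, by norm_num⟩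
    (by rw [yBCO7M_M18_tp, Entry.encl_ofEnds_fst, Entry.encl_ofEnds_snd]; constructor <;> norm_num)
    (by rw [yBCO7M_M18_n, Entry.encl_ofEnds_fst, Entry.encl_ofEnds_snd]; constructor <;> norm_num)
    (by norm_num)
    (by rw [yBCO7M_M18_tperp, Entry.encl_ofEnds_snd, yBCO7M_M18_U, Entry.encl_ofEnds_fst]; norm_num)
    dimer_V8_rows_k12 (c := (-0.1502043 : ℝ))
    (by
      rw [yBCO7M_M18_tperp, Entry.encl_ofEnds_fst, Entry.encl_ofEnds_snd, yBCO7M_M18_n, Entry.encl_ofEnds_fst,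
        Entry.encl_ofEnds_snd]
      intro z n hz hn
      push_cast at hz hn ⊢
      exact mul_half_affine_ge_of_corners (by norm_num) (by norm_num) (by norm_num) (by norm_num) (by norm_num) hz hn)
  have hmax : ((max |yBCO7M_M18_tperp.encl.fst| |yBCO7M_M18_tperp.encl.snd| : ℚ) : ℝ) = (9/20 : ℝ) := by
    rw [yBCO7M_M18_tperp, Entry.encl_ofEnds_fst, Entry.encl_ofEnds_snd]; norm_num
  rw [hmax] at h
  exact h

/-- **Decimal form**: `−2.160336 ≤ inf_{period-2 periodic, filling p n} e(bilayer crystal)` on `boxYBCO7M_M18` for every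
`|t⊥'| ≤ |p tperp/t|` (kinematic seam: `−2.4601316`). [cite: Anderson1951, eq. (2)] -/
theorem boxYBCO7M_M18_bilayer_floor_dimerV8_decimal :
    HoldsOn (fun p : OneBandCoord → ℝ => ∀ tperp' : ℝ, |tperp'| ≤ |p .tperpOverT| →
      (-2.160336 : ℝ) ≤
        infCellEnergyOn (periodicStatesAt (stackPeriods 2 1) (p .filling))
          (periodicLayeredHubbardTTPrimeViews 1 1 (p .tpOverT) (p .UOverT)
            (fun _ : Fin 1 => (unitVec (0 : Fin 3) : Site 3)) fun j _ => ![p .tperpOverT, tperp'] j) 1) boxYBCO7M_M18 := by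
  intro p hp tperp' htp
  have h := boxYBCO7M_M18_bilayer_floor_dimerV8 p hp tperp' htp
  norm_num at h ⊢
  linarith

end Summit.Ventures.CertifiedManyBodySolver.Downfold

end
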